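import Summits.CriticalPhenomena.PercolationContinuityZ3.Theorems.PercNearOneGluingNoHeavyLowerTailSahiOneStepCone
import HarnessLib

/-!
# One-step scheme: the FUZZY-COMPRESSION REDUCTION — a left-shifted fuzzy surrogate of `A` transfers `(2′)` from shifted pairs to
# (arbitrary `A`, shifted `B`)

Support file (prover prim-ineq-prove-3 gen 30; `--supports stmt-CriticalPhenomena-4575`; memo
`run/shared/lean/prim/prim-ineq-prove-3/PROOF-G30-SHIFTED-PARTNER.md` §1–3).  No definitions, no named facts, no sorries, no `native_decide`.

THEOREM SP of the memo: `(2′)` (hence Kahn C5 / Sahi C₃ for a Hamming-threshold first slot) holds for EVERY increasing `F`-determined `A` and every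
increasing `F`-determined `B` that is shifted w.r.t. some ranking of `F`, at every `p ∈ (0,1)^F`.  Its proof has three parts; this file is the
density-free, purely linear part:
* `cone_of_leftShifted_core` — a functional that is linear and nonnegative on indicators of LEFT-SHIFTED increasing `F`-determined events is
  nonnegative on every nonnegative increasing `F`-determined function that is left-shifted (`f ω ≤ f(ω − x + y)` for `σ y < σ x`, `x ∈ ω ∌ y`)
  (layer cake: the support of such a function is a left-shifted up-set, and peeling it keeps the class);
* `osN_sub_osN_surrogate` — for any `φ` with the same `H`-mass and total mass as `1_A` and no larger `H`-overlap with `g`: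
  `n(1_A, g) − n(φ, g) = (1 − E1_H)·(E[1_H 1_A g] − E[1_H φ g]) ≥ 0`;
* `osN_nonneg_of_leftShifted_surrogate` — hence, GIVEN `(2′)` for all (left-shifted, `B`) pairs of events (kernel: `…SahiOneStepOppositeShifted` for
  `B` right-shifted) and a left-shifted fuzzy surrogate `φ` of `A` dominated by `1_A` on `H ∩ B`, `0 ≤ n(H; 1_A, 1_B)`.
The existence of the surrogate (the FUZZY COMPRESSION LEMMA, memo §2: minimiser of `Σ w f²` under averaging compressions) is the remaining file.
-/

noncomputable section

namespace Summit.CriticalPhenomena.PercolationContinuityZ3.Theorems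

namespace SahiOneStep

open Literature.Combinatorics.Sahi2008
open Literature.Probability.Percolation (DeterminedBy determinedBy_iff)
open Literature.Probability.Percolation.DecisionTree (ind ind_of_mem ind_of_not_mem ind_nonneg)
open Literature.Probability.LatticeModels (prodBernoulli)
open SahiCdd (ex_congr' ex_lin2)
open scoped Classical

variable {ι : Type*} [Fintype ι]

/-! ## §1 The cone of left-shifted increasing functions -/

/-- **Cone lemma for left-shifted functions.**  Let `Φ` be linear with `Φ(1_U) ≥ 0` for every increasing `F`-determined `U` that is LEFT-SHIFTED
w.r.t. the ranking `σ` (`ω ∈ U`, `x, y ∈ F`, `σ y < σ x`, `x ∈ ω`, `y ∉ ω` ⟹ `(ω ∖ {x}) ∪ {y} ∈ U`).  Then `Φ f ≥ 0` for every nonnegative increasing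
`F`-determined `f` that is left-shifted as a function (`f ω ≤ f((ω ∖ {x}) ∪ {y})` under the same conditions). [this work] -/
theorem cone_of_leftShifted_core (F : Finset ι) (σ : ι → ℕ) (Φ : (Set ι → ℝ) → ℝ) (hlin : ∀ f f' a, Φ (f + a • f') = Φ f + a * Φ f')
    (hup : ∀ U : Set (Set ι), IsUpperSet U → DeterminedBy U (F : Set ι) →
      (∀ ω ∈ U, ∀ x ∈ F, ∀ y ∈ F, σ y < σ x → x ∈ ω → y ∉ ω → (ω \ {x}) ∪ {y} ∈ U) → 0 ≤ Φ (ind U)) :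
    ∀ f : Set ι → ℝ, Monotone f → (∀ ω, 0 ≤ f ω) → (∀ ω, f ω = f (ω ∩ (F : Set ι))) →
      (∀ ω : Set ι, ∀ x ∈ F, ∀ y ∈ F, σ y < σ x → x ∈ ω → y ∉ ω → f ω ≤ f ((ω \ {x}) ∪ {y})) → 0 ≤ Φ f := by
  have hzero : Φ 0 = 0 := by
    have h := hlin 0 0 1
    simp only [smul_zero, add_zero, one_mul] at h
    linarith
  suffices key : ∀ n : ℕ, ∀ f : Set ι → ℝ, (Finset.univ.filter fun ω => f ω ≠ 0).card ≤ n →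
      Monotone f → (∀ ω, 0 ≤ f ω) → (∀ ω, f ω = f (ω ∩ (F : Set ι))) →
      (∀ ω : Set ι, ∀ x ∈ F, ∀ y ∈ F, σ y < σ x → x ∈ ω → y ∉ ω → f ω ≤ f ((ω \ {x}) ∪ {y})) → 0 ≤ Φ f from
    fun f hf hf0 hfF hfs => key _ f le_rfl hf hf0 hfF hfs
  intro n
  induction n with
  | zero =>
    intro f hcard _ _ _ _
    have hf : f = 0 := by
      funext ω
      have : ω ∉ Finset.univ.filter fun ω => f ω ≠ 0 := by
        rw [Nat.le_zero, Finset.card_eq_zero] at hcard; rw [hcard]; exact Finset.notMem_empty ω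
      simpa [Finset.mem_filter] using this
    rw [hf, hzero]
  | succ n ih =>
    intro f hcard hmono hf0 hfF hfs
    by_cases hempty : (Finset.univ.filter fun ω => f ω ≠ 0) = ∅
    · exact ih f (by rw [hempty, Finset.card_empty]; exact Nat.zero_le _) hmono hf0 hfF hfs
    obtain ⟨ω₀, hω₀, hmin⟩ :=
      Finset.exists_min_image (Finset.univ.filter fun ω => f ω ≠ 0) f (Finset.nonempty_iff_ne_empty.2 hempty)
    have hω₀ne : f ω₀ ≠ 0 := (Finset.mem_filter.1 hω₀).2
    have hm : 0 < f ω₀ := lt_of_le_of_ne (hf0 ω₀) (Ne.symm hω₀ne)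
    set A : Set (Set ι) := {ω | f ω ≠ 0} with hA
    have hpos : ∀ ω, f ω ≠ 0 → 0 < f ω := fun ω hω => lt_of_le_of_ne (hf0 ω) (Ne.symm hω)
    have hAup : IsUpperSet A := by
      intro ω η hle hω
      exact ne_of_gt (lt_of_lt_of_le (hpos ω hω) (hmono hle))
    have hAF : DeterminedBy A (F : Set ι) := by
      rw [determinedBy_iff]
      intro ω η h
      simp only [hA, Set.mem_setOf_eq]
      rw [hfF ω, hfF η, h]
    have hAs : ∀ ω ∈ A, ∀ x ∈ F, ∀ y ∈ F, σ y < σ x → x ∈ ω → y ∉ ω → (ω \ {x}) ∪ {y} ∈ A := by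
      intro ω hω x hx y hy hyx hxω hyω
      exact ne_of_gt (lt_of_lt_of_le (hpos ω hω) (hfs ω x hx y hy hyx hxω hyω))
    set f' : Set ι → ℝ := fun ω => f ω - f ω₀ * ind A ω with hf'
    have hf'val : ∀ ω, f' ω = if f ω = 0 then 0 else f ω - f ω₀ := by
      intro ω
      by_cases h : f ω = 0
      · rw [if_pos h, hf']; simp only; rw [h, ind_of_not_mem (show ω ∉ A from fun h' => h' h)]; ring
      · rw [if_neg h, hf']; simp only; rw [ind_of_mem (show ω ∈ A from h)]; ring
    have hf'0 : ∀ ω, 0 ≤ f' ω := by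
      intro ω; rw [hf'val]
      by_cases h : f ω = 0
      · rw [if_pos h]
      · rw [if_neg h]; exact sub_nonneg.2 (hmin ω (Finset.mem_filter.2 ⟨Finset.mem_univ _, h⟩))
    have hf'le : ∀ ω η, f ω ≤ f η → f' ω ≤ f' η := by
      intro ω η hle
      rw [hf'val, hf'val]
      by_cases hω : f ω = 0
      · rw [if_pos hω]
        by_cases hη : f η = 0
        · rw [if_pos hη]
        · rw [if_neg hη]; exact sub_nonneg.2 (hmin η (Finset.mem_filter.2 ⟨Finset.mem_univ _, hη⟩))
      · have hη : f η ≠ 0 := ne_of_gt (lt_of_lt_of_le (hpos ω hω) hle)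
        rw [if_neg hω, if_neg hη]; exact sub_le_sub_right hle _
    have hf'mono : Monotone f' := fun ω η hle => hf'le ω η (hmono hle)
    have hf's : ∀ ω : Set ι, ∀ x ∈ F, ∀ y ∈ F, σ y < σ x → x ∈ ω → y ∉ ω → f' ω ≤ f' ((ω \ {x}) ∪ {y}) :=
      fun ω x hx y hy hyx hxω hyω => hf'le _ _ (hfs ω x hx y hy hyx hxω hyω)
    have hf'F : ∀ ω, f' ω = f' (ω ∩ (F : Set ι)) := by
      intro ω
      rw [hf'val, hf'val, ← hfF ω]
    have hcard' : (Finset.univ.filter fun ω => f' ω ≠ 0).card ≤ n := by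
      have hsub : (Finset.univ.filter fun ω => f' ω ≠ 0) ⊆ (Finset.univ.filter fun ω => f ω ≠ 0).erase ω₀ := by
        intro ω hω
        have hω' := (Finset.mem_filter.1 hω).2
        rw [Finset.mem_erase, Finset.mem_filter]
        refine ⟨?_, Finset.mem_univ _, ?_⟩
        · rintro rfl; rw [hf'val, if_neg hω₀ne, sub_self] at hω'; exact hω' rfl
        · intro h; rw [hf'val, if_pos h] at hω'; exact hω' rfl
      have := Finset.card_le_card hsub
      rw [Finset.card_erase_of_mem hω₀] at this
      omega
    have hdecomp : f = f' + f ω₀ • ind A := by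
      funext ω; simp only [hf', Pi.add_apply, Pi.smul_apply, smul_eq_mul]; ring
    rw [hdecomp, hlin]
    exact add_nonneg (ih f' hcard' hf'mono hf'0 hf'F hf's) (mul_nonneg hm.le (hup A hAup hAF hAs))

/-! ## §2 The surrogate comparison -/

/-- **Surrogate comparison.**  If `φ` has the same `H`-mass and the same total mass as `1_A`, and its `H`-overlap with `g` is at most that of `1_A`,
then `n(H; φ, g) ≤ n(H; 1_A, g)`; precisely `n(1_A,g) − n(φ,g) = (1 − E1_H)(E[1_H 1_A g] − E[1_H φ g])`. [this work] -/
theorem osN_sub_osN_surrogate (p : ι → unitInterval) (H A : Set (Set ι)) (φ g : Set ι → ℝ)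
    (hH : ex (bernoulliWeight p) (ind H * φ) = ex (bernoulliWeight p) (ind H * ind A))
    (h1 : ex (bernoulliWeight p) φ = ex (bernoulliWeight p) (ind A)) :
    osN p H (ind A) g - osN p H φ g =
      (1 - ex (bernoulliWeight p) (ind H)) * (ex (bernoulliWeight p) (ind H * ind A * g) - ex (bernoulliWeight p) (ind H * φ * g)) := by
  unfold osN osCert
  rw [hH, h1]
  ring

/-- Hence `n(H; φ, g) ≤ n(H; 1_A, g)` when additionally `E[1_H φ g] ≤ E[1_H 1_A g]`. [this work] -/
theorem osN_surrogate_le (p : ι → unitInterval) (H A : Set (Set ι)) (φ g : Set ι → ℝ)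
    (hH : ex (bernoulliWeight p) (ind H * φ) = ex (bernoulliWeight p) (ind H * ind A))
    (h1 : ex (bernoulliWeight p) φ = ex (bernoulliWeight p) (ind A))
    (hov : ex (bernoulliWeight p) (ind H * φ * g) ≤ ex (bernoulliWeight p) (ind H * ind A * g)) :
    osN p H φ g ≤ osN p H (ind A) g := by
  have h := osN_sub_osN_surrogate p H A φ g hH h1
  have hle : ex (bernoulliWeight p) (ind H) ≤ 1 := by
    rw [ex_bernoulliWeight_ind]; exact MeasureTheory.measureReal_le_one
  nlinarith [h, hle, hov]

/-! ## §3 The reduction -/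

/-- **THE FUZZY-COMPRESSION REDUCTION.**  Let `H` be an event, `B` an increasing `F`-determined event, `σ` a ranking, and suppose `(2′)` holds for
`H` and every pair (`U`, `B`) with `U` increasing, `F`-determined and left-shifted w.r.t. `σ` (kernel for `H = Th_t(F)` and `B` right-shifted:
`osN_threshold_nonneg_of_oppositeShifted`).  If `A` admits a LEFT-SHIFTED FUZZY SURROGATE `φ` — nonnegative, increasing, `F`-determined, left-shifted
as a function, with the `H`-mass and the total mass of `1_A` and no larger `H`-overlap with `1_B` — then `0 ≤ n(H; 1_A, 1_B)`. [this work] -/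
theorem osN_nonneg_of_leftShifted_surrogate (p : ι → unitInterval) (H : Set (Set ι)) (F : Finset ι) (σ : ι → ℕ) {A B : Set (Set ι)}
    (hS : ∀ U : Set (Set ι), IsUpperSet U → DeterminedBy U (F : Set ι) →
      (∀ ω ∈ U, ∀ x ∈ F, ∀ y ∈ F, σ y < σ x → x ∈ ω → y ∉ ω → (ω \ {x}) ∪ {y} ∈ U) → 0 ≤ osN p H (ind U) (ind B))
    (φ : Set ι → ℝ) (hφm : Monotone φ) (hφ0 : ∀ ω, 0 ≤ φ ω) (hφF : ∀ ω, φ ω = φ (ω ∩ (F : Set ι)))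
    (hφs : ∀ ω : Set ι, ∀ x ∈ F, ∀ y ∈ F, σ y < σ x → x ∈ ω → y ∉ ω → φ ω ≤ φ ((ω \ {x}) ∪ {y}))
    (hH : ex (bernoulliWeight p) (ind H * φ) = ex (bernoulliWeight p) (ind H * ind A))
    (h1 : ex (bernoulliWeight p) φ = ex (bernoulliWeight p) (ind A))
    (hov : ex (bernoulliWeight p) (ind H * φ * ind B) ≤ ex (bernoulliWeight p) (ind H * ind A * ind B)) :
    0 ≤ osN p H (ind A) (ind B) := by
  have hφpos : 0 ≤ osN p H φ (ind B) :=
    cone_of_leftShifted_core F σ (fun f => osN p H f (ind B)) (fun f f' a => osN_add_smul_left p H f f' (ind B) a) hS φ hφm hφ0 hφF hφs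
  exact hφpos.trans (osN_surrogate_le p H A φ (ind B) hH h1 hov)

end SahiOneStep

end Summit.CriticalPhenomena.PercolationContinuityZ3.Theorems
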